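import Literature.NumberTheory.Automorphic.CompactRepProjective
import HarnessLib

/-!
# Smooth duality and fixed vectors: the level bound behind "finitely generated admissible ⟹ finite length"

Generic smooth representation theory over `ℂ` (any topological group with a compact open
subgroup), assembling the duality half of Bernstein–Zelevinsky's argument that cuspidal
constituents of finitely generated representations have bounded level (Bernstein–Zelevinsky
1976, §2.4 and §3.3; 1977, Thm. 2.4 (a)–(b) and 2.14). Contents:

* transposes: `IntertwiningMap.dualMap` (`λ ↦ λ ∘ q` on algebraic duals) and
  `IntertwiningMap.contragredientMap` (its restriction to smooth duals), restriction of
  intertwining maps to a subgroup (`IntertwiningMap.restrictSubgroup`);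
* `Representation.dual_apply_avg`: a `K`-invariant linear form takes the same value on `v` and on
  its `K`-average; whence **(D3)** a non-zero `K`-invariant smooth form forces `V^K ≠ 0`
  (`fixedPoints_ne_bot_of_dual_invariant`) and **(D5)** the transpose of the inclusion of a
  subrepresentation is *surjective on smooth duals* (`contragredientMap_subtype_surjective`:
  extend `μ ∘ r ∘ e_K`);
* **(D1)** `exists_invariant_of_span_eq_top`: if `Z` is generated over a subgroup `H` by vectors
  fixed by compact subgroups `K i ≤ H`, every non-zero `H`-stable subspace of the smooth dual of
  `Z` contains a non-zero vector fixed by some `K i` (duality turns "generated by fixed vectors"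
  into "cogenerated");
* the lifting property of projective (compact irreducible) representations along smooth
  surjections (`exists_lift_of_isSupercuspidal`, from `exists_section_of_isSupercuspidal` of
  `CompactRepProjective` via a fibre product);
* the **abstract level bound** `fixedPoints_ne_bot_of_compact_constituent`: if `ρ` is a quotient
  of a subrepresentation of such a `Z` and the restriction to `H` of the contragredient `ρ̃` maps
  onto a compact irreducible admissible representation `κ` of `H`, then `ρ` has non-zero vectors
  fixed by some `K i`.

Theorems and four bundled-map constructions; no named facts.

## References

* I. N. Bernstein, A. V. Zelevinsky, *Representations of the group `GL(n, F)` where `F` is a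
  non-archimedean local field*, Russian Math. Surveys 31:3 (1976), §2.1–2.4, §3.3.
* I. N. Bernstein, A. V. Zelevinsky, *Induced representations of reductive `p`-adic groups I*,
  Ann. Sci. ÉNS 10 (1977), Thm. 2.4, 2.14.
-/

noncomputable section

open scoped Pointwise

namespace Representation

open Literature.NumberTheory.Automorphic Literature.NumberTheory.Automorphic.SmoothProjector
  Literature.RepresentationTheory.FiniteGroups Literature.RepresentationTheory.Semisimple

/-! ### Transposes and restriction to a subgroup -/

section Transpose

variable {k G V W : Type*} [CommRing k] [Group G] [AddCommGroup V] [Module k V]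
  [AddCommGroup W] [Module k W] {ρ : Representation k G V} {σ : Representation k G W}

/-- The **transpose** of an intertwining map `q : ρ → σ` on algebraic duals: `λ ↦ λ ∘ q`,
an intertwining map `σ^* → ρ^*`. [folklore] -/
def IntertwiningMap.dualMap (q : ρ.IntertwiningMap σ) : σ.dual.IntertwiningMap ρ.dual where
  toLinearMap := q.toLinearMap.dualMap
  isIntertwining' g := by
    refine LinearMap.ext fun lam => LinearMap.ext fun v => ?_
    simp only [LinearMap.coe_comp, Function.comp_apply, LinearMap.dualMap_apply, dual_apply,
      Module.Dual.transpose_apply, IntertwiningMap.coe_toLinearMap]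
    rw [q.isIntertwining]

/-- Unfolding lemma for the transpose. [folklore] -/
@[simp] theorem IntertwiningMap.dualMap_apply (q : ρ.IntertwiningMap σ) (lam : Module.Dual k W) (v : V) :
    q.dualMap lam v = lam (q v) := rfl

/-- The transpose of a surjection is injective. [folklore] -/
theorem IntertwiningMap.dualMap_injective {k : Type*} [Field k] [Module k V] [Module k W]
    {ρ : Representation k G V} {σ : Representation k G W} (q : ρ.IntertwiningMap σ)
    (hq : Function.Surjective q) : Function.Injective q.dualMap :=
  LinearMap.dualMap_injective_of_surjective (f := q.toLinearMap) hq

/-- An intertwining map of representations of `G` is an intertwining map of their restrictions to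
a subgroup `H`. [folklore] -/
def IntertwiningMap.restrictSubgroup (H : Subgroup G) (f : ρ.IntertwiningMap σ) :
    IntertwiningMap (ρ.comp H.subtype) (σ.comp H.subtype) where
  toLinearMap := f.toLinearMap
  isIntertwining' h := f.isIntertwining' h

/-- Unfolding lemma for `restrictSubgroup`. [folklore] -/
@[simp] theorem IntertwiningMap.restrictSubgroup_apply (H : Subgroup G) (f : ρ.IntertwiningMap σ) (v : V) :
    f.restrictSubgroup H v = f v := rfl

variable [TopologicalSpace G] [SeparatelyContinuousMul G]

/-- The **transpose on smooth duals**: `q : ρ → σ` induces `σ̃ → ρ̃`, `λ ↦ λ ∘ q` (smooth vectors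
go to smooth vectors). [folklore] -/
def IntertwiningMap.contragredientMap (q : ρ.IntertwiningMap σ) :
    σ.contragredientRep.IntertwiningMap ρ.contragredientRep where
  toLinearMap :=
    { toFun := fun lam => (⟨q.dualMap (Contragredient.subtype σ lam),
        IsSmoothVector.map q.dualMap lam.2⟩ : ↥ρ.contragredient.toSubmodule)
      map_add' := fun _ _ => Subtype.ext (map_add _ _ _)
      map_smul' := fun _ _ => Subtype.ext (map_smul _ _ _) }
  isIntertwining' g := LinearMap.ext fun _ => Subtype.ext (q.dualMap.isIntertwining _ _ g _)

/-- Unfolding lemma: the form underlying `contragredientMap q λ` is `λ ∘ q`. [folklore] -/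
@[simp] theorem IntertwiningMap.subtype_contragredientMap (q : ρ.IntertwiningMap σ) (lam : σ.Contragredient) :
    Contragredient.subtype ρ (q.contragredientMap lam) = q.dualMap (Contragredient.subtype σ lam) := rfl

/-- The transpose on smooth duals of a surjection is injective. [folklore] -/
theorem IntertwiningMap.contragredientMap_injective {k : Type*} [Field k] [Module k V] [Module k W]
    {ρ : Representation k G V} {σ : Representation k G W} (q : ρ.IntertwiningMap σ)
    (hq : Function.Surjective q) : Function.Injective q.contragredientMap := by
  intro a b hab
  have := congrArg (Contragredient.subtype ρ) hab
  rw [q.subtype_contragredientMap, q.subtype_contragredientMap] at this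
  exact Contragredient.subtype_injective σ (q.dualMap_injective hq this)

end Transpose

/-! ### Invariant forms and averages -/

section Average

variable {k G V : Type*} [Field k] [CharZero k] [Group G] [TopologicalSpace G] [IsTopologicalGroup G]
  [AddCommGroup V] [Module k V] {ρ : Representation k G V}

/-- **A `K`-invariant linear form is unchanged by `K`-averaging its argument**:
`μ (e_K v) = μ v`. [folklore] -/
theorem dual_apply_avg {K : Subgroup G} (hK : IsCompact (K : Set G)) {v : V} (hv : ρ.IsSmoothVector v)
    {μ : Module.Dual k V} (hμ : ∀ g ∈ K, ρ.dual g μ = μ) : μ (avg ρ K v) = μ v := by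
  haveI := finiteIndex_stabIn hK hv
  haveI : Fintype (K ⧸ stabIn ρ K v) := Fintype.ofFinite _
  have hμ' : ∀ g ∈ K, ∀ w, μ (ρ g w) = μ w := fun g hg w => by
    have := LinearMap.congr_fun (hμ g⁻¹ (K.inv_mem hg)) w
    simpa [dual_apply, Module.Dual.transpose_apply] using this
  rw [avg_eq_index_inv_smul_finsum (stabIn ρ K v) le_rfl, map_smul, finsum_eq_sum_of_fintype, map_sum]
  simp only [fun q : K ⧸ stabIn ρ K v => hμ' _ (q.out).2 v, Finset.sum_const, Finset.card_univ]
  rw [← Nat.cast_smul_eq_nsmul k, smul_smul, Subgroup.index, Nat.card_eq_fintype_card, inv_mul_cancel₀,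
    one_smul]
  exact Nat.cast_ne_zero.2 Fintype.card_ne_zero

/-- **(D3) A non-zero `K`-invariant form forces non-zero `K`-fixed vectors** (`K` compact, `ρ`
smooth): if `μ v ≠ 0` then `e_K v ∈ V^K` has `μ (e_K v) = μ v ≠ 0`. [folklore] -/
theorem fixedPoints_ne_bot_of_dual_invariant (hρ : ρ.IsSmooth) {K : Subgroup G} (hK : IsCompact (K : Set G))
    {μ : Module.Dual k V} (hμ : ∀ g ∈ K, ρ.dual g μ = μ) (hμ0 : μ ≠ 0) : ρ.fixedPoints K ≠ ⊥ := by
  obtain ⟨v, hv⟩ : ∃ v, μ v ≠ 0 := by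
    by_contra h
    push Not at h
    exact hμ0 (LinearMap.ext h)
  intro hbot
  have hmem : avg ρ K v ∈ ρ.fixedPoints K := avg_mem_fixedPoints hK (hρ v)
  rw [hbot, Submodule.mem_bot] at hmem
  apply hv
  rw [← dual_apply_avg hK (hρ v) hμ, hmem, map_zero]

/-- **(D5) Smooth forms on a subrepresentation extend to smooth forms**: for a subrepresentation
`A ≤ Z` of a smooth representation and a `K`-invariant form `μ` on `A` (`K` compact), there is a
`K`-invariant form on `Z` extending `μ`, namely `μ ∘ r ∘ e_K` for any linear retraction `r` of
the inclusion. [folklore] -/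
theorem exists_dual_invariant_extension (hρ : ρ.IsSmooth) (A : Subrepresentation ρ) {K : Subgroup G}
    (hK : IsCompact (K : Set G)) (μ : Module.Dual k A.toSubmodule)
    (hμ : ∀ g ∈ K, A.toRepresentation.dual g μ = μ) :
    ∃ Λ : Module.Dual k V, (∀ g ∈ K, ρ.dual g Λ = Λ) ∧ ∀ a : A.toSubmodule, Λ a = μ a := by
  obtain ⟨r, hr⟩ := LinearMap.exists_leftInverse_of_injective A.toSubmodule.subtype
    (LinearMap.ker_eq_bot.2 Subtype.val_injective)
  refine ⟨μ ∘ₗ r ∘ₗ avgLinear K hρ hK, fun g hg => ?_, fun a => ?_⟩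
  · ext z
    simp only [dual_apply, Module.Dual.transpose_apply, LinearMap.comp_apply, avgLinear_apply]
    rw [avg_apply_of_mem (K.inv_mem hg)]
  · have hav : (avg ρ K (a : V)) = ((avg A.toRepresentation K a : A.toSubmodule) : V) :=
      (map_avg hK (Subrepresentation.subtypeIntertwiningMap A) (IsSmooth.toRepresentation hρ A a)).symm
    have hr' : ∀ x : A.toSubmodule, r (x : V) = x := fun x => by
      simpa using LinearMap.congr_fun hr x
    rw [LinearMap.comp_apply, LinearMap.comp_apply, avgLinear_apply, hav, hr',
      dual_apply_avg hK (IsSmooth.toRepresentation hρ A a) hμ]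

/-- **The transpose of the inclusion of a subrepresentation is surjective on smooth duals**
(`G` with a compact open subgroup `K₀`, `Z` smooth): every smooth form on `A` is the restriction
of a smooth form on `Z`. (Bernstein–Zelevinsky 1976, §2.1–2.3: `V ↦ Ṽ` is exact.) [folklore] -/
theorem contragredientMap_subtype_surjective (hρ : ρ.IsSmooth) {K₀ : Subgroup G}
    (hK₀o : IsOpen (K₀ : Set G)) (hK₀c : IsCompact (K₀ : Set G)) (A : Subrepresentation ρ) :
    Function.Surjective (Subrepresentation.subtypeIntertwiningMap A).contragredientMap := by
  intro μ
  set K : Subgroup G := K₀ ⊓ A.toRepresentation.dual.stabilizerSubgroup (Contragredient.subtype _ μ) with hKdef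
  have hKo : IsOpen (K : Set G) := hK₀o.inter μ.2
  have hKc : IsCompact (K : Set G) := hK₀c.of_isClosed_subset (Subgroup.isClosed_of_isOpen _ hKo) fun g hg => hg.1
  obtain ⟨Λ, hΛK, hΛ⟩ := exists_dual_invariant_extension hρ A hKc (Contragredient.subtype _ μ)
    fun g hg => hg.2
  refine ⟨⟨Λ, ρ.dual.isSmoothVector_of_le hKo fun g hg => hΛK g hg⟩, ?_⟩
  apply Contragredient.subtype_injective
  rw [IntertwiningMap.subtype_contragredientMap]
  ext a
  exact hΛ a

end Average

/-! ### (D1) Duality turns generation by fixed vectors into cogeneration -/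

section Cogeneration

variable {k G V : Type*} [Field k] [CharZero k] [Group G] [TopologicalSpace G] [IsTopologicalGroup G]
  [AddCommGroup V] [Module k V] {ρ : Representation k G V}

/-- The `K`-average of a smooth form takes the value `μ z` at every `K`-fixed vector `z`. [folklore] -/
theorem avg_dual_apply_of_mem_fixedPoints {K : Subgroup G} (hK : IsCompact (K : Set G))
    {μ : Module.Dual k V} (hμ : ρ.dual.IsSmoothVector μ) {z : V} (hz : z ∈ ρ.fixedPoints K) :
    (avg ρ.dual K μ) z = μ z := by
  haveI := finiteIndex_stabIn hK hμ
  haveI : Fintype (K ⧸ stabIn ρ.dual K μ) := Fintype.ofFinite _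
  rw [mem_fixedPoints] at hz
  have hterm : ∀ q : K ⧸ stabIn ρ.dual K μ, (ρ.dual ((q.out : K) : G) μ) z = μ z := fun q => by
    simp only [dual_apply, Module.Dual.transpose_apply, LinearMap.comp_apply]
    rw [hz _ (K.inv_mem (q.out).2)]
  rw [avg_eq_index_inv_smul_finsum (stabIn ρ.dual K μ) le_rfl, LinearMap.smul_apply, finsum_eq_sum_of_fintype,
    LinearMap.sum_apply]
  simp only [hterm, Finset.sum_const, Finset.card_univ]
  rw [← Nat.cast_smul_eq_nsmul k, smul_smul, Subgroup.index, Nat.card_eq_fintype_card, inv_mul_cancel₀,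
    one_smul]
  exact Nat.cast_ne_zero.2 Fintype.card_ne_zero

/-- The `K`-average of a form in a subspace `S` stable under `K` lies in `S`. [folklore] -/
theorem avg_dual_mem {K : Subgroup G} (hK : IsCompact (K : Set G)) (S : Submodule k (Module.Dual k V))
    (hS : ∀ g ∈ K, ∀ μ ∈ S, ρ.dual g μ ∈ S) {μ : Module.Dual k V} (hμS : μ ∈ S)
    (hμ : ρ.dual.IsSmoothVector μ) : avg ρ.dual K μ ∈ S := by
  haveI := finiteIndex_stabIn hK hμ
  haveI : Fintype (K ⧸ stabIn ρ.dual K μ) := Fintype.ofFinite _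
  rw [avg_eq_index_inv_smul_finsum (stabIn ρ.dual K μ) le_rfl, finsum_eq_sum_of_fintype]
  exact S.smul_mem _ (S.sum_mem fun q _ => hS _ (q.out).2 μ hμS)

/-- **(D1) Cogeneration by duality.** Let `ρ` be smooth and generated, over a subgroup `H`, by
vectors fixed by compact subgroups `K i ≤ H`:
`span {ρ(h) z : h ∈ H, z ∈ V^{K i}} = V`. Then every `H`-stable subspace `S` of smooth linear
forms containing a non-zero form contains a non-zero form fixed by some `K i`: if `μ₀ ∈ S` is
non-zero it is non-zero on some `ρ(h) z`, so `ρ^*(h⁻¹) μ₀ ∈ S` is non-zero on `z ∈ V^{K i}`, and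
its `K i`-average is a `K i`-fixed element of `S` with the same (non-zero) value at `z`.
(Bernstein–Zelevinsky 1976, §2.3–2.4; the duality half of 1977, 2.14.) [folklore] -/
theorem exists_dual_invariant_of_span_eq_top (H : Subgroup G) {ι : Type*} (K : ι → Subgroup G)
    (hKc : ∀ i, IsCompact (K i : Set G)) (hKH : ∀ i, K i ≤ H)
    (hgen : Submodule.span k {x | ∃ h ∈ H, ∃ i, ∃ z ∈ ρ.fixedPoints (K i), x = ρ h z} = ⊤)
    (S : Submodule k (Module.Dual k V)) (hS : ∀ h ∈ H, ∀ μ ∈ S, ρ.dual h μ ∈ S)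
    (hSs : ∀ μ ∈ S, ρ.dual.IsSmoothVector μ) {μ₀ : Module.Dual k V} (hμ₀S : μ₀ ∈ S) (hμ₀ : μ₀ ≠ 0) :
    ∃ i, ∃ μ ∈ S, μ ≠ 0 ∧ ∀ g ∈ K i, ρ.dual g μ = μ := by
  -- `μ₀` is non-zero on some generator `ρ(h) z`
  obtain ⟨h, hh, i, z, hz, hne⟩ : ∃ h ∈ H, ∃ i, ∃ z ∈ ρ.fixedPoints (K i), μ₀ (ρ h z) ≠ 0 := by
    by_contra hcon
    push Not at hcon
    apply hμ₀
    refine LinearMap.ext fun x => ?_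
    have hx : x ∈ Submodule.span k {x | ∃ h ∈ H, ∃ i, ∃ z ∈ ρ.fixedPoints (K i), x = ρ h z} := by
      rw [hgen]; trivial
    rw [LinearMap.zero_apply]
    refine Submodule.span_induction (fun y hy => ?_) (map_zero μ₀) (fun a b _ _ ha hb => by rw [map_add, ha, hb, add_zero])
      (fun c a _ ha => by rw [map_smul, ha, smul_zero]) hx
    obtain ⟨h, hh, i, z, hz, rfl⟩ := hy
    exact hcon h hh i z hz
  -- translate and average
  set μ₁ : Module.Dual k V := ρ.dual h⁻¹ μ₀ with hμ₁
  have hμ₁S : μ₁ ∈ S := hS h⁻¹ (H.inv_mem hh) μ₀ hμ₀S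
  have hμ₁s : ρ.dual.IsSmoothVector μ₁ := (hSs μ₀ hμ₀S).apply ρ.dual h⁻¹
  have hμ₁z : μ₁ z = μ₀ (ρ h z) := by
    simp [hμ₁, dual_apply, Module.Dual.transpose_apply]
  refine ⟨i, avg ρ.dual (K i) μ₁, avg_dual_mem (hKc i) S (fun g hg μ hμ => hS g (hKH i hg) μ hμ) hμ₁S hμ₁s,
    fun h0 => hne ?_, fun g hg => ?_⟩
  · rw [← hμ₁z, ← avg_dual_apply_of_mem_fixedPoints (hKc i) hμ₁s hz, h0, LinearMap.zero_apply]
  · exact (mem_fixedPoints _ _ _).1 (avg_mem_fixedPoints (hKc i) hμ₁s) g hg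

end Cogeneration

/-! ### The lifting property of compact irreducible representations -/

section Lifting

variable {G V : Type*} [Group G] [TopologicalSpace G] [IsTopologicalGroup G]
  [AddCommGroup V] [Module ℂ V] {κ : Representation ℂ G V} {K₀ : Subgroup G}
  (hK₀o : IsOpen (K₀ : Set G)) (hK₀c : IsCompact (K₀ : Set G)) (hsc : κ.IsSupercuspidal)
  (hZ : IsCompact (Subgroup.center G : Set G)) (hκ : κ.IsAdmissible)

omit [IsTopologicalGroup G] in
/-- Products of smooth representations are smooth. [folklore] -/
theorem IsSmooth.prod [SeparatelyContinuousMul G] {Y₁ Y₂ : Type*} [AddCommGroup Y₁] [Module ℂ Y₁]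
    [AddCommGroup Y₂] [Module ℂ Y₂] {σ₁ : Representation ℂ G Y₁} {σ₂ : Representation ℂ G Y₂}
    (h₁ : σ₁.IsSmooth) (h₂ : σ₂.IsSmooth) : (σ₁.prod σ₂).IsSmooth := by
  intro y
  refine (σ₁.prod σ₂).isSmoothVector_of_le (K := σ₁.stabilizerSubgroup y.1 ⊓ σ₂.stabilizerSubgroup y.2)
    ((h₁ y.1).inter (h₂ y.2)) fun g hg => ?_
  rw [mem_stabilizerSubgroup, prod_apply_apply]
  exact Prod.ext hg.1 hg.2

include hK₀o hK₀c hsc hZ hκ in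
/-- **Lifting property**: a compact irreducible admissible `κ` lifts along smooth surjections:
for `r : σ₁ → σ₂` surjective with `σ₁` smooth and `j : κ → σ₂`, there is `j' : κ → σ₁` with
`r ∘ j' = j` (apply the splitting property to the fibre product `σ₁ ×_{σ₂} κ → κ`).
[cite: BernsteinZelevinsky1976, Thm. 2.44] -/
theorem exists_lift_of_isSupercuspidal [κ.IsIrreducible] {Y₁ Y₂ : Type*} [AddCommGroup Y₁] [Module ℂ Y₁]
    [AddCommGroup Y₂] [Module ℂ Y₂] {σ₁ : Representation ℂ G Y₁} {σ₂ : Representation ℂ G Y₂}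
    (hσ₁ : σ₁.IsSmooth) (r : σ₁.IntertwiningMap σ₂) (hr : Function.Surjective r)
    (j : κ.IntertwiningMap σ₂) : ∃ j' : κ.IntertwiningMap σ₁, ∀ v, r (j' v) = j v := by
  -- the fibre product `P = {(y, v) | r y = j v}` as a subrepresentation of `σ₁ × κ`
  set d : (σ₁.prod κ).IntertwiningMap σ₂ :=
    (r.comp (IntertwiningMap.fst ℂ σ₁ κ)) - (j.comp (IntertwiningMap.snd ℂ σ₁ κ)) with hd
  set P : Subrepresentation (σ₁.prod κ) := d.ker with hP
  have hPmem : ∀ y : Y₁ × V, y ∈ P ↔ r y.1 = j y.2 := fun y => by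
    rw [hP, IntertwiningMap.mem_ker, hd, IntertwiningMap.coe_sub, Pi.sub_apply, sub_eq_zero]
    rfl
  have hPs : P.toRepresentation.IsSmooth := IsSmooth.toRepresentation (hσ₁.prod hκ.isSmooth) P
  -- the projection `P → κ` is surjective
  set p₂ : P.toRepresentation.IntertwiningMap κ :=
    (IntertwiningMap.snd ℂ σ₁ κ).comp (Subrepresentation.subtypeIntertwiningMap P) with hp₂
  have hp₂ : Function.Surjective p₂ := fun v => by
    obtain ⟨y, hy⟩ := hr (j v)
    exact ⟨⟨(y, v), (hPmem _).2 hy⟩, rfl⟩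
  obtain ⟨s, hs⟩ := exists_section_of_isSupercuspidal hK₀o hK₀c hsc hZ hκ hPs p₂ hp₂
  refine ⟨(IntertwiningMap.fst ℂ σ₁ κ).comp ((Subrepresentation.subtypeIntertwiningMap P).comp s), fun v => ?_⟩
  have hmem := (hPmem _).1 (s v).2
  change r ((s v : Y₁ × V).1) = j v
  rw [hmem]
  exact congrArg j (hs v)

end Lifting

/-! ### The abstract level bound -/

section LevelBound

variable {L : Type*} [Group L] [TopologicalSpace L] [IsTopologicalGroup L]

omit [IsTopologicalGroup L] in
/-- Restricting a smooth representation to a subgroup (with the subspace topology) gives a smooth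
representation. [folklore] -/
theorem IsSmooth.compSubtype {V : Type*} [AddCommGroup V] [Module ℂ V] {ρ : Representation ℂ L V}
    (hρ : ρ.IsSmooth) (H : Subgroup L) : IsSmooth (ρ.comp H.subtype) := fun v =>
  (hρ v).preimage continuous_subtype_val

omit [IsTopologicalGroup L] in
/-- A compact subgroup `K₀ ≤ H` of `L` is a compact subgroup of `↥H`. [folklore] -/
theorem isCompact_subgroupOf {H K₀ : Subgroup L} (hK₀c : IsCompact (K₀ : Set L)) (hK₀H : K₀ ≤ H) :
    IsCompact ((K₀.subgroupOf H : Subgroup H) : Set H) := by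
  rw [Topology.IsEmbedding.subtypeVal.isCompact_iff]
  convert hK₀c
  ext x
  constructor
  · rintro ⟨y, hy, rfl⟩
    exact hy
  · intro hx
    exact ⟨⟨x, hK₀H hx⟩, hx, rfl⟩

/-- **The abstract level bound** (the core of "finitely generated admissible ⟹ finite length",
Bernstein–Zelevinsky 1976, §3.3; 1977, 2.14, combined with the projectivity of compact
representations, 1976, Thm. 2.44). Let `H ≤ L` be an open subgroup containing a compact open
subgroup `K₀` of `L` and with compact centre; let `Z` be a smooth representation of `L` generated
over `H` by vectors fixed by compact subgroups `K i ≤ H`; let `ρ` be a smooth quotient of a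
subrepresentation `A ≤ Z`; and suppose the restriction to `H` of the contragredient `ρ̃` maps
onto an irreducible admissible representation `κ` of `H` with compactly supported matrix
coefficients. Then `ρ` has a non-zero vector fixed by some `K i`.

Proof: a section `s : κ → ρ̃|_H` (projectivity), the injection `j = q^~ ∘ s : κ → Ã|_H`, its lift
`j' : κ → Z̃|_H` along the surjection `Z̃ → Ã` (D5), cogeneration (D1) applied to the image of
`j'` gives a non-zero `K i`-fixed vector of `κ`, whose image under `s` is a non-zero `K i`-fixed
smooth form on `ρ`, whence `ρ^{K i} ≠ 0` (D3). [cite: BernsteinZelevinsky1976, Thm. 2.44] -/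
theorem exists_fixedPoints_ne_bot_of_compact_constituent (H : Subgroup L) {K₀ : Subgroup L}
    (hK₀o : IsOpen (K₀ : Set L)) (hK₀c : IsCompact (K₀ : Set L)) (hK₀H : K₀ ≤ H)
    (hZH : IsCompact (Subgroup.center H : Set H))
    {Vz : Type*} [AddCommGroup Vz] [Module ℂ Vz] {Z : Representation ℂ L Vz} (hZ : Z.IsSmooth)
    {ι : Type*} (K : ι → Subgroup L) (hKc : ∀ i, IsCompact (K i : Set L)) (hKH : ∀ i, K i ≤ H)
    (hgen : Submodule.span ℂ {x | ∃ h ∈ H, ∃ i, ∃ z ∈ Z.fixedPoints (K i), x = Z h z} = ⊤)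
    {Vρ : Type*} [AddCommGroup Vρ] [Module ℂ Vρ] {ρ : Representation ℂ L Vρ} (hρ : ρ.IsSmooth)
    (A : Subrepresentation Z) (q : A.toRepresentation.IntertwiningMap ρ) (hq : Function.Surjective q)
    {Vκ : Type*} [AddCommGroup Vκ] [Module ℂ Vκ] {κ : Representation ℂ H Vκ} [κ.IsIrreducible]
    (hκa : κ.IsAdmissible) (hκs : κ.IsSupercuspidal)
    (p : IntertwiningMap (ρ.contragredientRep.comp H.subtype) κ) (hp : Function.Surjective p) :
    ∃ i, ρ.fixedPoints (K i) ≠ ⊥ := by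
  -- compact open subgroup of `H`
  have hK₀'o : IsOpen ((K₀.subgroupOf H : Subgroup H) : Set H) := hK₀o.preimage continuous_subtype_val
  have hK₀'c : IsCompact ((K₀.subgroupOf H : Subgroup H) : Set H) := isCompact_subgroupOf hK₀c hK₀H
  -- the smooth representations of `H` in play
  have hσρs : IsSmooth (ρ.contragredientRep.comp H.subtype) := (ρ.isSmooth_contragredientRep).compSubtype H
  have hσZs : IsSmooth (Z.contragredientRep.comp H.subtype) := (Z.isSmooth_contragredientRep).compSubtype H
  -- section of `p`
  obtain ⟨s, hs⟩ := exists_section_of_isSupercuspidal hK₀'o hK₀'c hκs hZH hκa hσρs p hp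
  have hsinj : Function.Injective s := fun a b hab => by rw [← hs a, ← hs b, hab]
  -- `j : κ → Ã|_H`, injective
  let j : IntertwiningMap κ (A.toRepresentation.contragredientRep.comp H.subtype) :=
    (q.contragredientMap.restrictSubgroup H).comp s
  have hT_j : ∀ v, j v = q.contragredientMap (s v) := fun v => rfl
  have hjinj : Function.Injective j := fun a b hab =>
    hsinj (q.contragredientMap_injective hq (by rw [← hT_j, ← hT_j, hab]))
  -- `r : Z̃|_H ↠ Ã|_H` and the lift `j' : κ → Z̃|_H`
  let r : IntertwiningMap (Z.contragredientRep.comp H.subtype) (A.toRepresentation.contragredientRep.comp H.subtype) :=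
    (Subrepresentation.subtypeIntertwiningMap A).contragredientMap.restrictSubgroup H
  have hrsurj : Function.Surjective r := contragredientMap_subtype_surjective hZ hK₀o hK₀c A
  obtain ⟨j', hj'⟩ := exists_lift_of_isSupercuspidal hK₀'o hK₀'c hκs hZH hκa hσZs r hrsurj j
  have hj'inj : Function.Injective j' := fun a b hab => hjinj (by rw [← hj' a, ← hj' b, hab])
  -- the `H`-stable space of smooth forms `S = κ ↪ Z̃ ⊂ Vz^*`
  let T : Vκ →ₗ[ℂ] Module.Dual ℂ Vz := (Contragredient.subtype Z).comp j'.toLinearMap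
  have hT_apply : ∀ v, T v = Contragredient.subtype Z (j' v) := fun v => rfl
  have hTinj : Function.Injective T := (Contragredient.subtype_injective Z).comp hj'inj
  have hTequiv : ∀ (h : L) (hh : h ∈ H) (v : Vκ), T (κ ⟨h, hh⟩ v) = Z.dual h (T v) := fun h hh v => by
    rw [hT_apply, hT_apply, j'.isIntertwining]
    rfl
  let S : Submodule ℂ (Module.Dual ℂ Vz) := LinearMap.range T
  have hS : ∀ h ∈ H, ∀ μ ∈ S, Z.dual h μ ∈ S := by
    rintro h hh _ ⟨v, rfl⟩
    exact ⟨κ ⟨h, hh⟩ v, hTequiv h hh v⟩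
  have hSs : ∀ μ ∈ S, Z.dual.IsSmoothVector μ := by
    rintro _ ⟨v, rfl⟩
    exact (j' v).2
  haveI : Nontrivial Vκ := IsIrreducible.nontrivial κ
  obtain ⟨v₀, hv₀⟩ := exists_ne (0 : Vκ)
  have hμ₀ : T v₀ ≠ 0 := fun h0 => hv₀ (hTinj (by rw [h0, map_zero]))
  obtain ⟨i, μ, ⟨v, rfl⟩, hμ0, hμK⟩ :=
    exists_dual_invariant_of_span_eq_top H K hKc hKH hgen S hS hSs ⟨v₀, rfl⟩ hμ₀
  -- `v ∈ κ` is non-zero and `K i`-fixed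
  have hv0 : v ≠ 0 := fun h0 => hμ0 (by rw [h0, map_zero])
  have hvK : ∀ (g : L) (hg : g ∈ K i), κ ⟨g, hKH i hg⟩ v = v := fun g hg =>
    hTinj (by rw [hTequiv, hμK g hg])
  -- the smooth form `s v` on `ρ` is non-zero and `K i`-invariant
  refine ⟨i, fixedPoints_ne_bot_of_dual_invariant hρ (hKc i) (μ := Contragredient.subtype ρ (s v))
    (fun g hg => ?_) ?_⟩
  · have : Contragredient.subtype ρ ((ρ.contragredientRep.comp H.subtype) ⟨g, hKH i hg⟩ (s v)) =
        ρ.dual g (Contragredient.subtype ρ (s v)) := rfl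
    rw [← this, ← s.isIntertwining, hvK g hg]
  · intro h0
    apply hv0
    apply hsinj
    apply Contragredient.subtype_injective ρ
    rw [h0, map_zero, map_zero]

end LevelBound

end Representation
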